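import Summits.NavierStokesRegularity.NavierStokesRegularity.Theses.AxisymmetricExtremality
import Literature.Analysis.FluidPDE.AxisymNoSwirlLocalMaxPrinciple
import Literature.Analysis.FluidPDE.AxisymHouLiVariables
import HarnessLib

/-!
# Seregin 2022, §2 Step 3 for the LOCAL smooth class (VIII): joint continuity of the smooth
# radial quotients `Γ = ω_θ/r`, `Φ = ω_r/r`, … of a family of smooth fields from uniform-in-`x`
# time moduli of its `x`-derivatives — crux stmt-NavierStokesRegularity-15453
# (`AxisymmetricExtremality.AxisymmetricKatoGlobal`), line registered, support for stub `stub_sereginLogSwirlOrigin`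

Support file (`--supports stmt-NavierStokesRegularity-15453`; theorems only, everything proved)
toward the registered stub `stub_sereginLogSwirlOrigin` = the named fact
`Literature.Analysis.FluidPDE.seregin2022_logSwirl_regularAtOrigin` (G. Seregin, J. Math. Fluid
Mech. 24 (2022), Paper 27 = arXiv:2201.00153, §2). The key estimate of Step 3 for the local
class (`cutoff_energy_keyEstimate_local_unconditional`, sibling `…Step3LocalKeyEstimate0`) asks
for the joint continuity on the slab of the smooth quotients `Γ = angVortQuot (v t)`,
`Φ = radVelQuot (curl (v t))`, of their gradients and of `angVelQuot W`, `radVelQuot W` (`W` the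
vorticity right-hand side). For the cut-off globalisation `χV` of the Seregin–Zajaczkowski
representative the available time regularity is that of the class: all spatial derivatives
jointly continuous, which — `χV` having its support in a fixed compact set — is the uniform-in-`x`
continuity in time of every `D_xᵏ(χV)` (the `hunif` moduli of the tree's no-swirl maximum
principle, `AxisymNoSwirlLocalMaxPrinciple`). This file transfers such moduli through the
LINEAR operations building the quotients, with the sup bounds of the tree:

* `radDerivQuot_sub`, `radQuot_sub` — linearity of the smooth radial quotients
  `(∂ᵣS)/r = hadamardQuotFst (∂₀S)`, `S/r² = radQuot S`;
* `radQuot_sub_bounds` — `|radQuot S₁ − radQuot S₂| ≤ D₂/2`, `‖D(radQuot S₁) − D(radQuot S₂)‖ ≤ D₃/2`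
  from `‖D²S₁ − D²S₂‖ ≤ D₂`, `‖D³S₁ − D³S₂‖ ≤ D₃` (`abs_radQuot_le`, `norm_fderiv_radQuot_le`,
  `norm_fderiv_hadamardQuotFst_le`);
* `continuousOn_radQuot_family` (registered sub-goal) — **a scalar family `F` with smooth slices
  and uniform-in-`x` time moduli of `D²F`, `D³F` on `S` has `(t, x) ↦ radQuot (F t) x` and
  `(t, x) ↦ D(radQuot (F t))(x)` jointly continuous on `S × ℝ³`** (`continuousOn_prod_of_unifTime`);
* `unifTime_mono_order` — moduli for all orders at once up to `k`;
* `unifTime_curl` — the moduli pass to `curl` (`‖Dⁿ curl f‖ ≤ ‖curlCLM‖‖Dⁿ⁺¹f‖`);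
* `unifTime_bilinear` — and through a continuous bilinear pairing `B (f t y) (g t y)` of two
  families with moduli, the second supported in a fixed ball (Leibniz bound
  `ContinuousLinearMap.norm_iteratedFDeriv_le_of_bilinear`; off the ball everything vanishes) —
  covering `swirl w = ⟪Jy, w⟫`, `⟪y_h, w⟫`, and the products `Dω[u]`, `Du[ω]` of `W`.

## Mathlib / tree search

Tree: `continuousOn_prod_of_unifTime`, `curl_apply_one_unifTime`, `scalar_family_continuousOn`
(`AxisymNoSwirlLocalMaxPrinciple`, the same transfer for `hadamardQuotFst (curl W)₁`),
`hadamardQuotFst_sub`, `hadamardQuotFst_liftData_sub_bounds`, `norm_iteratedFDeriv_clm_apply_fderiv_le`,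
`norm_fderiv_fderiv_apply_le_of_smooth`, `fderiv_apply_sub_of_smooth` (`KNSSThm52Assembly`),
`abs_radQuot_le`, `abs_radDerivQuot_le`, `norm_fderiv_radQuot_le`, `hasFDerivAt_radQuot`,
`continuous_scaleH_left` (`AxisymRadialQuotient`), `norm_fderiv_hadamardQuotFst_le` (`HadamardQuotient`).
Mathlib: `ContinuousLinearMap.norm_iteratedFDeriv_le_of_bilinear`, `ContinuousLinearMap.iteratedFDeriv_comp_left`,
`norm_iteratedFDeriv_fderiv`, `Filter.EventuallyEq.iteratedFDeriv`, `iteratedFDeriv_sub_apply`.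
`lean search 'radQuot_sub|unifTime_bilinear|radQuot_family' --decl`: no matches (2026-08-17).

## References

* G. Seregin, J. Math. Fluid Mech. 24 (2022), Paper No. 27 = arXiv:2201.00153, §2 Step 3
  (arXiv pp. 6–7). [`Seregin2022LocalAxisym`]
-/

noncomputable section

open MeasureTheory Set Filter Topology Function Metric
open scoped ContDiff RealInnerProductSpace
open Literature.Analysis.FluidPDE

-- `<Problem> = <Summit>` duplicates a namespace component by design (lakefile sets the same option).
set_option linter.dupNamespace false

namespace Summit.NavierStokesRegularity.NavierStokesRegularity.Theorems.AxisymmetricKatoGlobal.EulerScaling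

/-! ### Linearity and Lipschitz bounds of the smooth radial quotients -/

section RadQuot

variable {S₁ S₂ : EuclideanSpace ℝ (Fin 3) → ℝ}

/-- Linearity of the radial derivative quotient `(∂ᵣS)/r = hadamardQuotFst (∂₀S)`. [folklore] -/
theorem radDerivQuot_sub (hS₁ : ContDiff ℝ ∞ S₁) (hS₂ : ContDiff ℝ ∞ S₂) :
    radDerivQuot (S₁ - S₂) = radDerivQuot S₁ - radDerivQuot S₂ := by
  unfold radDerivQuot
  rw [fderiv_apply_sub_of_smooth hS₁ hS₂]
  exact hadamardQuotFst_sub ((contDiff_infty_fderiv_apply hS₁ _).of_le (by norm_cast))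
    ((contDiff_infty_fderiv_apply hS₂ _).of_le (by norm_cast))

/-- Linearity of the radial quotient `S/r² = radQuot S`. [folklore] -/
theorem radQuot_sub (hS₁ : ContDiff ℝ ∞ S₁) (hS₂ : ContDiff ℝ ∞ S₂) (x : EuclideanSpace ℝ (Fin 3)) :
    radQuot (S₁ - S₂) x = radQuot S₁ x - radQuot S₂ x := by
  have hint : ∀ {S : EuclideanSpace ℝ (Fin 3) → ℝ}, ContDiff ℝ ∞ S →
      IntervalIntegrable (fun s : ℝ => s * radDerivQuot S (scaleH s x)) volume 0 1 := fun hS =>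
    (continuous_id.mul ((continuous_radDerivQuot (hS.of_le (by norm_cast))).comp
      (continuous_scaleH_left x))).intervalIntegrable 0 1
  unfold radQuot
  rw [radDerivQuot_sub hS₁ hS₂, ← intervalIntegral.integral_sub (hint hS₁) (hint hS₂)]
  refine intervalIntegral.integral_congr fun s _ => ?_
  simp only [Pi.sub_apply]
  ring

/-- **Lipschitz dependence of `radQuot S` and its gradient on `D²S`, `D³S`**: for smooth `S₁, S₂`
with `‖D²S₁ − D²S₂‖ ≤ D₂`, `‖D³S₁ − D³S₂‖ ≤ D₃` everywhere,
`|radQuot S₁ x − radQuot S₂ x| ≤ D₂/2` and `‖D(radQuot S₁)(x) − D(radQuot S₂)(x)‖ ≤ D₃/2`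
(everything is linear in `S`; `abs_radQuot_le`, `norm_fderiv_radQuot_le`). [folklore] -/
theorem radQuot_sub_bounds (hS₁ : ContDiff ℝ ∞ S₁) (hS₂ : ContDiff ℝ ∞ S₂) {D₂ D₃ : ℝ}
    (h2 : ∀ y, ‖iteratedFDeriv ℝ 2 S₁ y - iteratedFDeriv ℝ 2 S₂ y‖ ≤ D₂)
    (h3 : ∀ y, ‖iteratedFDeriv ℝ 3 S₁ y - iteratedFDeriv ℝ 3 S₂ y‖ ≤ D₃)
    (x : EuclideanSpace ℝ (Fin 3)) :
    |radQuot S₁ x - radQuot S₂ x| ≤ D₂ / 2 ∧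
    ‖fderiv ℝ (radQuot S₁) x - fderiv ℝ (radQuot S₂) x‖ ≤ D₃ / 2 := by
  set S : EuclideanSpace ℝ (Fin 3) → ℝ := S₁ - S₂ with hSdef
  have hS : ContDiff ℝ ∞ S := hS₁.sub hS₂
  have hiter : ∀ (k : ℕ) (y : EuclideanSpace ℝ (Fin 3)),
      iteratedFDeriv ℝ k S y = iteratedFDeriv ℝ k S₁ y - iteratedFDeriv ℝ k S₂ y := fun k y =>
    iteratedFDeriv_sub_apply (hS₁.of_le (natCast_le_contDiff_infty k)).contDiffAt
      (hS₂.of_le (natCast_le_contDiff_infty k)).contDiffAt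
  have h2' : ∀ y, ‖iteratedFDeriv ℝ 2 S y‖ ≤ D₂ := fun y => by rw [hiter]; exact h2 y
  have h3' : ∀ y, ‖iteratedFDeriv ℝ 3 S y‖ ≤ D₃ := fun y => by rw [hiter]; exact h3 y
  have he : ‖(EuclideanSpace.single (0 : Fin 3) (1 : ℝ))‖ = 1 := by rw [PiLp.norm_single, norm_one]
  -- `|radDerivQuot S| ≤ D₂`
  have hB2 : ∀ y, ‖fderiv ℝ (fun y => fderiv ℝ S y (EuclideanSpace.single 0 1)) y‖ ≤ D₂ := fun y => by
    have h := norm_fderiv_fderiv_apply_le_of_smooth hS y (EuclideanSpace.single 0 1)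
    rw [he, one_mul] at h
    exact h.trans (h2' y)
  have hq : ∀ y, |radDerivQuot S y| ≤ D₂ := abs_radDerivQuot_le hB2
  -- `‖D(radDerivQuot S)‖ ≤ D₃`
  set w : EuclideanSpace ℝ (Fin 3) → ℝ := fun y => fderiv ℝ S y (EuclideanSpace.single 0 1) with hw
  have hwS : ContDiff ℝ ∞ w := contDiff_infty_fderiv_apply hS _
  have hB3 : ∀ y, ‖fderiv ℝ (fun y => fderiv ℝ w y (EuclideanSpace.single 0 1)) y‖ ≤ D₃ := fun y => by
    have h := norm_fderiv_fderiv_apply_le_of_smooth hwS y (EuclideanSpace.single 0 1)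
    rw [he, one_mul] at h
    refine h.trans ?_
    have h' := norm_iteratedFDeriv_clm_apply_fderiv_le
      (ContinuousLinearMap.apply ℝ ℝ (EuclideanSpace.single (0 : Fin 3) (1 : ℝ))) hS 2 y
    simp only [ContinuousLinearMap.apply_apply] at h'
    have hΛ : ‖ContinuousLinearMap.apply ℝ ℝ (EuclideanSpace.single (0 : Fin 3) (1 : ℝ))‖ ≤ 1 := by
      refine ContinuousLinearMap.opNorm_le_bound _ zero_le_one fun L => ?_
      rw [ContinuousLinearMap.apply_apply, one_mul]
      simpa [he] using L.le_opNorm (EuclideanSpace.single (0 : Fin 3) (1 : ℝ))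
    calc ‖iteratedFDeriv ℝ 2 w y‖ ≤ ‖ContinuousLinearMap.apply ℝ ℝ (EuclideanSpace.single (0 : Fin 3) (1 : ℝ))‖ *
          ‖iteratedFDeriv ℝ 3 S y‖ := h'
      _ ≤ 1 * D₃ := mul_le_mul hΛ (h3' y) (norm_nonneg _) zero_le_one
      _ = D₃ := one_mul _
  have hDq : ∀ y, ‖fderiv ℝ (radDerivQuot S) y‖ ≤ D₃ := fun y =>
    norm_fderiv_hadamardQuotFst_le (hwS.of_le (by norm_cast)) hB3 y
  -- linearity
  have hsub : radQuot S = radQuot S₁ - radQuot S₂ := funext fun y => radQuot_sub hS₁ hS₂ y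
  have hr₁ : ContDiff ℝ ∞ (radQuot S₁) := contDiff_radQuot (n := ⊤) (by exact_mod_cast hS₁)
  have hr₂ : ContDiff ℝ ∞ (radQuot S₂) := contDiff_radQuot (n := ⊤) (by exact_mod_cast hS₂)
  refine ⟨?_, ?_⟩
  · have h := abs_radQuot_le hq x
    rwa [hsub, Pi.sub_apply] at h
  · have h := norm_fderiv_radQuot_le (hS.of_le (by norm_cast)) hDq x
    rwa [hsub, fderiv_sub ((hr₁.differentiable (by simp)) x) ((hr₂.differentiable (by simp)) x)] at h

end RadQuot

/-! ### Joint continuity of radial quotients from uniform-in-`x` time moduli -/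

section Family

variable {S : Set ℝ} {F : ℝ → EuclideanSpace ℝ (Fin 3) → ℝ}

/-- **Joint continuity of `radQuot (F t) x` and of its gradient from uniform-in-`x` time
moduli.** If every slice `F t`, `t ∈ S`, is smooth and the derivatives `D²F`, `D³F` are
continuous in `t` uniformly in `x` on `S` (`‖DᵏF(t', y) − DᵏF(t, y)‖ ≤ ε` for `|t' − t| < δ`,
all `y`, `k = 2, 3`), then `(t, x) ↦ radQuot (F t) x` and `(t, x) ↦ D(radQuot (F t))(x)` are
continuous on `S × ℝ³` (`radQuot_sub_bounds` and `continuousOn_prod_of_unifTime`). For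
`F t = swirl (curl (v t))` this is the joint continuity of `Γ = ω_θ/r` and `∇Γ`, for
`F t = ⟪x_h, curl (v t)⟫` that of `Φ = ω_r/r` and `∇Φ`, for `F t = swirl W(t)`, `⟪x_h, W(t)⟫`
(`W` the vorticity right-hand side) that of the time derivatives `∂ₜΓ`, `∂ₜΦ` of Step 3 for the
local smooth class. Registered sub-goal toward `stub_sereginLogSwirlOrigin`. [folklore] -/
theorem continuousOn_radQuot_family : ∀ (S : Set ℝ) (F : ℝ → EuclideanSpace ℝ (Fin 3) → ℝ), (∀ t ∈ S, ContDiff ℝ (⊤ : ℕ∞) (F t)) → (∀ k : ℕ, k = 2 ∨ k = 3 → ∀ t ∈ S, ∀ ε > 0, ∃ δ > 0, ∀ t' ∈ S, |t' - t| < δ → ∀ y, ‖iteratedFDeriv ℝ k (F t') y - iteratedFDeriv ℝ k (F t) y‖ ≤ ε) → ContinuousOn (fun z : ℝ × EuclideanSpace ℝ (Fin 3) => radQuot (F z.1) z.2) (S ×ˢ univ) ∧ ContinuousOn (fun z : ℝ × EuclideanSpace ℝ (Fin 3) => fderiv ℝ (radQuot (F z.1)) z.2) (S ×ˢ univ) :=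 by
  intro S F hF hU
  have hmod : ∀ t ∈ S, ∀ ε > 0, ∃ δ > 0, ∀ t' ∈ S, |t' - t| < δ → ∀ x,
      |radQuot (F t') x - radQuot (F t) x| ≤ ε ∧
      ‖fderiv ℝ (radQuot (F t')) x - fderiv ℝ (radQuot (F t)) x‖ ≤ ε := by
    intro t ht ε hε
    obtain ⟨δ₂, hδ₂, h₂⟩ := hU 2 (Or.inl rfl) t ht ε hε
    obtain ⟨δ₃, hδ₃, h₃⟩ := hU 3 (Or.inr rfl) t ht ε hε
    refine ⟨min δ₂ δ₃, lt_min hδ₂ hδ₃, fun t' ht' hlt x => ?_⟩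
    have hb := radQuot_sub_bounds (hF t' ht') (hF t ht)
      (h₂ t' ht' (hlt.trans_le (min_le_left _ _))) (h₃ t' ht' (hlt.trans_le (min_le_right _ _))) x
    exact ⟨hb.1.trans (by linarith), hb.2.trans (by linarith)⟩
  have hsl : ∀ t ∈ S, ContDiff ℝ ∞ (radQuot (F t)) := fun t ht =>
    contDiff_radQuot (n := ⊤) (by exact_mod_cast hF t ht)
  refine ⟨?_, ?_⟩
  · refine continuousOn_prod_of_unifTime (ψ := fun t x => radQuot (F t) x) (fun t ht ε hε => ?_)
      fun t ht => (hsl t ht).continuous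
    obtain ⟨δ, hδ, h⟩ := hmod t ht ε hε
    exact ⟨δ, hδ, fun t' ht' hlt x => by rw [Real.norm_eq_abs]; exact (h t' ht' hlt x).1⟩
  · refine continuousOn_prod_of_unifTime (ψ := fun t x => fderiv ℝ (radQuot (F t)) x)
      (fun t ht ε hε => ?_) fun t ht => (hsl t ht).continuous_fderiv (by simp)
    obtain ⟨δ, hδ, h⟩ := hmod t ht ε hε
    exact ⟨δ, hδ, fun t' ht' hlt x => (h t' ht' hlt x).2⟩

end Family

/-! ### Transfer of uniform-in-`x` time moduli through linear and bilinear operations -/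

section Transfer

variable {S : Set ℝ}

/-- Moduli for all orders `≤ k` at once. [folklore] -/
theorem unifTime_mono_order {E : Type*} [NormedAddCommGroup E] [NormedSpace ℝ E]
    {f : ℝ → EuclideanSpace ℝ (Fin 3) → E}
    (hU : ∀ k : ℕ, ∀ t ∈ S, ∀ ε > 0, ∃ δ > 0, ∀ t' ∈ S, |t' - t| < δ → ∀ y,
      ‖iteratedFDeriv ℝ k (f t') y - iteratedFDeriv ℝ k (f t) y‖ ≤ ε)
    (k : ℕ) {t : ℝ} (ht : t ∈ S) {ε : ℝ} (hε : 0 < ε) :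
    ∃ δ > 0, ∀ j ≤ k, ∀ t' ∈ S, |t' - t| < δ → ∀ y,
      ‖iteratedFDeriv ℝ j (f t') y - iteratedFDeriv ℝ j (f t) y‖ ≤ ε := by
  induction k with
  | zero =>
    obtain ⟨δ, hδ, h⟩ := hU 0 t ht ε hε
    exact ⟨δ, hδ, fun j hj => by obtain rfl : j = 0 := Nat.le_zero.1 hj; exact h⟩
  | succ k ih =>
    obtain ⟨δ₁, hδ₁, h₁⟩ := ih
    obtain ⟨δ₂, hδ₂, h₂⟩ := hU (k + 1) t ht ε hε
    refine ⟨min δ₁ δ₂, lt_min hδ₁ hδ₂, fun j hj t' ht' hlt y => ?_⟩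
    rcases Nat.of_le_succ hj with hj' | rfl
    · exact h₁ j hj' t' ht' (hlt.trans_le (min_le_left _ _)) y
    · exact h₂ t' ht' (hlt.trans_le (min_le_right _ _)) y

/-- **The moduli pass to the curl**: `‖Dⁿ curl f‖ ≤ ‖curlCLM‖ ‖Dⁿ⁺¹ f‖` and linearity. [folklore] -/
theorem unifTime_curl {u : ℝ → EuclideanSpace ℝ (Fin 3) → EuclideanSpace ℝ (Fin 3)}
    (hu : ∀ t ∈ S, ContDiff ℝ ∞ (u t))
    (hU : ∀ k : ℕ, ∀ t ∈ S, ∀ ε > 0, ∃ δ > 0, ∀ t' ∈ S, |t' - t| < δ → ∀ y,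
      ‖iteratedFDeriv ℝ k (u t') y - iteratedFDeriv ℝ k (u t) y‖ ≤ ε) :
    ∀ k : ℕ, ∀ t ∈ S, ∀ ε > 0, ∃ δ > 0, ∀ t' ∈ S, |t' - t| < δ → ∀ y,
      ‖iteratedFDeriv ℝ k (curl (u t')) y - iteratedFDeriv ℝ k (curl (u t)) y‖ ≤ ε := by
  intro k t ht ε hε
  obtain ⟨δ, hδ, h⟩ := hU (k + 1) t ht (ε / (‖curlCLM‖ + 1)) (by positivity)
  refine ⟨δ, hδ, fun t' ht' hlt y => ?_⟩
  have hd : ContDiff ℝ ∞ (u t' - u t) := (hu t' ht').sub (hu t ht)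
  have hcurl : curl (u t') - curl (u t) = curl (u t' - u t) := by
    funext z
    show curlCLM (fderiv ℝ (u t') z) - curlCLM (fderiv ℝ (u t) z) = curlCLM (fderiv ℝ (u t' - u t) z)
    rw [fderiv_sub (((hu t' ht').differentiable (by simp)) z) (((hu t ht).differentiable (by simp)) z),
      map_sub]
  have hc' : ∀ s ∈ S, ContDiff ℝ k (curl (u s)) := fun s hs =>
    contDiff_curl (n := k) ((hu s hs).of_le (by exact_mod_cast le_top))
  rw [← iteratedFDeriv_sub_apply (hc' t' ht').contDiffAt (hc' t ht).contDiffAt, hcurl]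
  -- `‖Dᵏ curl d‖ ≤ ‖curlCLM‖ ‖Dᵏ⁺¹ d‖`
  have hD : ContDiff ℝ k (fderiv ℝ (u t' - u t)) := hd.fderiv_right (m := k) (by exact_mod_cast le_top)
  have hle : ‖iteratedFDeriv ℝ k (curl (u t' - u t)) y‖ ≤ ‖curlCLM‖ * ‖iteratedFDeriv ℝ (k + 1) (u t' - u t) y‖ := by
    rw [show curl (u t' - u t) = curlCLM ∘ fderiv ℝ (u t' - u t) from rfl,
      curlCLM.iteratedFDeriv_comp_left hD.contDiffAt (i := k) (by exact_mod_cast le_rfl),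
      ← norm_iteratedFDeriv_fderiv]
    exact ContinuousLinearMap.norm_compContinuousMultilinearMap_le _ _
  rw [iteratedFDeriv_sub_apply ((hu t' ht').of_le (natCast_le_contDiff_infty _)).contDiffAt
    ((hu t ht).of_le (natCast_le_contDiff_infty _)).contDiffAt] at hle
  refine hle.trans ?_
  have h0 : 0 ≤ ‖curlCLM‖ := norm_nonneg curlCLM
  calc ‖curlCLM‖ * ‖iteratedFDeriv ℝ (k + 1) (u t') y - iteratedFDeriv ℝ (k + 1) (u t) y‖
      ≤ ‖curlCLM‖ * (ε / (‖curlCLM‖ + 1)) := mul_le_mul_of_nonneg_left (h t' ht' hlt y) h0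
    _ ≤ ε := by rw [mul_div_assoc', div_le_iff₀ (by positivity)]; nlinarith

/-- A uniform bound for the derivatives of order `≤ k` of a smooth function on a closed ball.
[folklore] -/
theorem exists_forall_norm_iteratedFDeriv_le_closedBall {H : Type*} [NormedAddCommGroup H] [NormedSpace ℝ H]
    {φ : EuclideanSpace ℝ (Fin 3) → H} (hφ : ContDiff ℝ ∞ φ) (R : ℝ) (k : ℕ) :
    ∃ C, 0 ≤ C ∧ ∀ j ≤ k, ∀ y ∈ closedBall (0 : EuclideanSpace ℝ (Fin 3)) R, ‖iteratedFDeriv ℝ j φ y‖ ≤ C := by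
  have hone : ∀ j : ℕ, ∃ C, ∀ y ∈ closedBall (0 : EuclideanSpace ℝ (Fin 3)) R, ‖iteratedFDeriv ℝ j φ y‖ ≤ C :=
    fun j => (isCompact_closedBall _ _).exists_bound_of_continuousOn
      ((hφ.continuous_iteratedFDeriv (by exact_mod_cast le_top)).continuousOn)
  induction k with
  | zero =>
    obtain ⟨C, hC⟩ := hone 0
    exact ⟨max C 0, le_max_right _ _, fun j hj y hy => by
      obtain rfl : j = 0 := Nat.le_zero.1 hj; exact (hC y hy).trans (le_max_left _ _)⟩
  | succ k ih =>
    obtain ⟨C₁, hC₁0, hC₁⟩ := ih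
    obtain ⟨C₂, hC₂⟩ := hone (k + 1)
    refine ⟨max C₁ C₂, le_max_of_le_left hC₁0, fun j hj y hy => ?_⟩
    rcases Nat.of_le_succ hj with hj' | rfl
    · exact (hC₁ j hj' y hy).trans (le_max_left _ _)
    · exact (hC₂ y hy).trans (le_max_right _ _)

/-- **The moduli pass through a continuous bilinear pairing** `B (f t y) (g t y)` of two families
with smooth slices and uniform-in-`y` time moduli of all `y`-derivatives on `S`, the second family
supported in a fixed ball `B̄(0, R)` (off which the pairing vanishes identically): for every `k`,
`‖Dᵏ(B f g)(t', y) − Dᵏ(B f g)(t, y)‖ ≤ ε` for `|t' − t| < δ`, all `y`. Leibniz bound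
(`ContinuousLinearMap.norm_iteratedFDeriv_le_of_bilinear`) for `B (f'−f) g' + B f (g'−g)`, the
derivatives of `f`, `g'` being bounded on the ball uniformly for `t'` near `t`. Covers
`swirl w = ⟪Jy, w y⟫`, `⟪y_h, w y⟫` (constant left family) and the products `Dω[u]`, `Du[ω]`.
[folklore] -/
theorem unifTime_bilinear {E F G : Type*} [NormedAddCommGroup E] [NormedSpace ℝ E]
    [NormedAddCommGroup F] [NormedSpace ℝ F] [NormedAddCommGroup G] [NormedSpace ℝ G]
    (B : E →L[ℝ] F →L[ℝ] G) {f : ℝ → EuclideanSpace ℝ (Fin 3) → E}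
    {g : ℝ → EuclideanSpace ℝ (Fin 3) → F} {R : ℝ}
    (hf : ∀ t ∈ S, ContDiff ℝ ∞ (f t)) (hg : ∀ t ∈ S, ContDiff ℝ ∞ (g t))
    (hgR : ∀ t ∈ S, ∀ y, R < ‖y‖ → g t y = 0)
    (hUf : ∀ k : ℕ, ∀ t ∈ S, ∀ ε > 0, ∃ δ > 0, ∀ t' ∈ S, |t' - t| < δ → ∀ y,
      ‖iteratedFDeriv ℝ k (f t') y - iteratedFDeriv ℝ k (f t) y‖ ≤ ε)
    (hUg : ∀ k : ℕ, ∀ t ∈ S, ∀ ε > 0, ∃ δ > 0, ∀ t' ∈ S, |t' - t| < δ → ∀ y,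
      ‖iteratedFDeriv ℝ k (g t') y - iteratedFDeriv ℝ k (g t) y‖ ≤ ε) :
    ∀ k : ℕ, ∀ t ∈ S, ∀ ε > 0, ∃ δ > 0, ∀ t' ∈ S, |t' - t| < δ → ∀ y,
      ‖iteratedFDeriv ℝ k (fun y => B (f t' y) (g t' y)) y -
        iteratedFDeriv ℝ k (fun y => B (f t y) (g t y)) y‖ ≤ ε := by
  intro k t ht ε hε
  -- bounds for `Dʲ f t`, `Dʲ g t`, `j ≤ k`, on the ball `B̄(0, R)`
  obtain ⟨Cf, hCf0, hCf⟩ := exists_forall_norm_iteratedFDeriv_le_closedBall (hf t ht) R k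
  obtain ⟨Cg, hCg0, hCg⟩ := exists_forall_norm_iteratedFDeriv_le_closedBall (hg t ht) R k
  -- the constant of the Leibniz bound
  set M : ℝ := ‖B‖ * (2 ^ k * ((Cg + 1) + Cf)) + 1 with hM
  have hMpos : 0 < M := by positivity
  obtain ⟨δf, hδf, hmf⟩ := unifTime_mono_order hUf k ht (ε := ε / M) (by positivity)
  obtain ⟨δg, hδg, hmg⟩ := unifTime_mono_order hUg k ht (ε := min (ε / M) 1) (by positivity)
  refine ⟨min δf δg, lt_min hδf hδg, fun t' ht' hlt y => ?_⟩
  have hltf : |t' - t| < δf := hlt.trans_le (min_le_left _ _)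
  have hltg : |t' - t| < δg := hlt.trans_le (min_le_right _ _)
  have hcast : ∀ m : ℕ, ((m : ℕ∞) : WithTop ℕ∞) ≤ ((⊤ : ℕ∞) : WithTop ℕ∞) := fun m => by exact_mod_cast le_top
  -- the difference as a sum of two pairings
  have hP : ∀ s ∈ S, ContDiff ℝ ∞ fun y => B (f s y) (g s y) := fun s hs =>
    B.isBoundedBilinearMap.contDiff.comp ((hf s hs).prodMk (hg s hs))
  have hdf : ContDiff ℝ ∞ fun y => f t' y - f t y := (hf t' ht').sub (hf t ht)
  have hdg : ContDiff ℝ ∞ fun y => g t' y - g t y := (hg t' ht').sub (hg t ht)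
  have hP1 : ContDiff ℝ ∞ fun y => B (f t' y - f t y) (g t' y) :=
    B.isBoundedBilinearMap.contDiff.comp (hdf.prodMk (hg t' ht'))
  have hP2 : ContDiff ℝ ∞ fun y => B (f t y) (g t' y - g t y) :=
    B.isBoundedBilinearMap.contDiff.comp ((hf t ht).prodMk hdg)
  have hsplit : (fun y => B (f t' y) (g t' y)) - (fun y => B (f t y) (g t y)) =
      (fun y => B (f t' y - f t y) (g t' y)) + fun y => B (f t y) (g t' y - g t y) := by
    funext z
    simp only [Pi.sub_apply, Pi.add_apply, map_sub, _root_.sub_apply]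
    abel
  rw [← iteratedFDeriv_sub_apply ((hP t' ht').of_le (hcast k)).contDiffAt ((hP t ht).of_le (hcast k)).contDiffAt,
    hsplit]
  by_cases hy : R < ‖y‖
  · -- off the ball both pairings vanish near `y`
    have hopen : IsOpen {z : EuclideanSpace ℝ (Fin 3) | R < ‖z‖} := isOpen_lt continuous_const continuous_norm
    have hz : (fun y => B (f t' y - f t y) (g t' y)) + (fun y => B (f t y) (g t' y - g t y)) =ᶠ[𝓝 y]
        fun _ => 0 := by
      filter_upwards [hopen.mem_nhds hy] with z hz
      simp [hgR t' ht' z hz, hgR t ht z hz]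
    rw [(hz.iteratedFDeriv ℝ k).self_of_nhds, iteratedFDeriv_fun_zero, Pi.zero_apply, norm_zero]
    exact hε.le
  · -- on the ball: Leibniz for both pairings
    have hyR : y ∈ closedBall (0 : EuclideanSpace ℝ (Fin 3)) R := mem_closedBall_zero_iff.2 (not_lt.1 hy)
    have hsum : ∑ i ∈ Finset.range (k + 1), (k.choose i : ℝ) = 2 ^ k := by exact_mod_cast Nat.sum_range_choose k
    -- first pairing: `‖Dⁱ(f' − f)‖ ≤ ε/M`, `‖Dᵏ⁻ⁱ g'‖ ≤ Cg + 1`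
    have hg' : ∀ j ≤ k, ‖iteratedFDeriv ℝ j (g t') y‖ ≤ Cg + 1 := fun j hj => by
      have h1 := hmg j hj t' ht' hltg y
      have h2 := hCg j hj y hyR
      calc ‖iteratedFDeriv ℝ j (g t') y‖
          = ‖(iteratedFDeriv ℝ j (g t') y - iteratedFDeriv ℝ j (g t) y) + iteratedFDeriv ℝ j (g t) y‖ := by
            rw [sub_add_cancel]
        _ ≤ ‖iteratedFDeriv ℝ j (g t') y - iteratedFDeriv ℝ j (g t) y‖ + ‖iteratedFDeriv ℝ j (g t) y‖ :=
            norm_add_le _ _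
        _ ≤ 1 + Cg := add_le_add (h1.trans (min_le_right _ _)) h2
        _ = Cg + 1 := add_comm _ _
    have hdf' : ∀ j ≤ k, ‖iteratedFDeriv ℝ j (fun y => f t' y - f t y) y‖ ≤ ε / M := fun j hj => by
      rw [show (fun y => f t' y - f t y) = f t' - f t from rfl,
        iteratedFDeriv_sub_apply ((hf t' ht').of_le (hcast j)).contDiffAt ((hf t ht).of_le (hcast j)).contDiffAt]
      exact hmf j hj t' ht' hltf y
    have hdg' : ∀ j ≤ k, ‖iteratedFDeriv ℝ j (fun y => g t' y - g t y) y‖ ≤ ε / M := fun j hj => by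
      rw [show (fun y => g t' y - g t y) = g t' - g t from rfl,
        iteratedFDeriv_sub_apply ((hg t' ht').of_le (hcast j)).contDiffAt ((hg t ht).of_le (hcast j)).contDiffAt]
      exact (hmg j hj t' ht' hltg y).trans (min_le_left _ _)
    have hL1 := B.norm_iteratedFDeriv_le_of_bilinear hdf (hg t' ht') y (n := k) (by exact_mod_cast le_top)
    have hL2 := B.norm_iteratedFDeriv_le_of_bilinear (hf t ht) hdg y (n := k) (by exact_mod_cast le_top)
    have hT1 : ∑ i ∈ Finset.range (k + 1), (k.choose i : ℝ) * ‖iteratedFDeriv ℝ i (fun y => f t' y - f t y) y‖ *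
        ‖iteratedFDeriv ℝ (k - i) (g t') y‖ ≤ ∑ i ∈ Finset.range (k + 1), (k.choose i : ℝ) * (ε / M) * (Cg + 1) := by
      refine Finset.sum_le_sum fun i hi => ?_
      have hik : i ≤ k := Nat.lt_succ_iff.1 (Finset.mem_range.1 hi)
      have h1 := hdf' i hik
      have h2 := hg' (k - i) (Nat.sub_le _ _)
      have h0 : 0 ≤ (k.choose i : ℝ) := by positivity
      calc (k.choose i : ℝ) * ‖iteratedFDeriv ℝ i (fun y => f t' y - f t y) y‖ * ‖iteratedFDeriv ℝ (k - i) (g t') y‖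
          ≤ (k.choose i : ℝ) * (ε / M) * ‖iteratedFDeriv ℝ (k - i) (g t') y‖ :=
            mul_le_mul_of_nonneg_right (mul_le_mul_of_nonneg_left h1 h0) (norm_nonneg _)
        _ ≤ (k.choose i : ℝ) * (ε / M) * (Cg + 1) :=
            mul_le_mul_of_nonneg_left h2 (by positivity)
    have hT2 : ∑ i ∈ Finset.range (k + 1), (k.choose i : ℝ) * ‖iteratedFDeriv ℝ i (f t) y‖ *
        ‖iteratedFDeriv ℝ (k - i) (fun y => g t' y - g t y) y‖ ≤ ∑ i ∈ Finset.range (k + 1), (k.choose i : ℝ) * Cf * (ε / M) := by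
      refine Finset.sum_le_sum fun i hi => ?_
      have hik : i ≤ k := Nat.lt_succ_iff.1 (Finset.mem_range.1 hi)
      have h1 := hCf i hik y hyR
      have h2 := hdg' (k - i) (Nat.sub_le _ _)
      have h0 : 0 ≤ (k.choose i : ℝ) := by positivity
      calc (k.choose i : ℝ) * ‖iteratedFDeriv ℝ i (f t) y‖ * ‖iteratedFDeriv ℝ (k - i) (fun y => g t' y - g t y) y‖
          ≤ (k.choose i : ℝ) * Cf * ‖iteratedFDeriv ℝ (k - i) (fun y => g t' y - g t y) y‖ :=
            mul_le_mul_of_nonneg_right (mul_le_mul_of_nonneg_left h1 h0) (norm_nonneg _)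
        _ ≤ (k.choose i : ℝ) * Cf * (ε / M) := mul_le_mul_of_nonneg_left h2 (by positivity)
    rw [← Finset.sum_mul, ← Finset.sum_mul, hsum] at hT1 hT2
    have hB0 : 0 ≤ ‖B‖ := norm_nonneg B
    have hadd : ‖iteratedFDeriv ℝ k ((fun y => B (f t' y - f t y) (g t' y)) + fun y => B (f t y) (g t' y - g t y)) y‖ ≤
        ‖B‖ * (2 ^ k * (ε / M) * (Cg + 1)) + ‖B‖ * (2 ^ k * Cf * (ε / M)) := by
      rw [iteratedFDeriv_add_apply (hP1.of_le (hcast k)).contDiffAt (hP2.of_le (hcast k)).contDiffAt]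
      refine (norm_add_le _ _).trans (add_le_add ?_ ?_)
      · exact hL1.trans (mul_le_mul_of_nonneg_left hT1 hB0)
      · exact hL2.trans (mul_le_mul_of_nonneg_left hT2 hB0)
    refine hadd.trans ?_
    have hkey : ‖B‖ * (2 ^ k * (ε / M) * (Cg + 1)) + ‖B‖ * (2 ^ k * Cf * (ε / M)) =
        (‖B‖ * (2 ^ k * ((Cg + 1) + Cf))) * (ε / M) := by ring
    rw [hkey, mul_div_assoc', div_le_iff₀ hMpos, hM]
    nlinarith [mul_nonneg hB0 (show (0:ℝ) ≤ 2 ^ k * ((Cg + 1) + Cf) by positivity)]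
end Transfer

end Summit.NavierStokesRegularity.NavierStokesRegularity.Theorems.AxisymmetricKatoGlobal.EulerScaling

end
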